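import Mathlib
import Summits.ValiantsHypothesis.ValiantsHypothesis.Theorems.RigidityForcesSymmetryRankRigidMinimalReprLaplaceFiveSeparatedCaptureProlongation

/-!
# ValiantsHypothesis / RigidityForcesSymmetry — crux `LaplaceOptimalFive` (stmt-ValiantsHypothesis-24813), symmetric capture:
# ★ **THE EQUALITY CASE OF `dim X ≤ 3 ⇒ dim X⁽¹⁾ ≤ 4`: A 3-SPACE OF QUADRICS WITH A 4-DIMENSIONAL PROLONGATION IS A BINARY NET**

val-lit-p6 g18 ↔ crit-3 g9 (2026-08-29; the «DICHOTOMY» lemma of the `(2,2,2)♭`-triangle route, located note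
`pub/val-lit/lmr/NOTE-p6g18-24813-222flat-located.md`).  If a space `X` of symmetric `5 × 5` matrices has `finrank X ≤ 3` and
`finrank (prolong X) ≥ 4` (so `= 4` by ✓ `finrank_prolong_le_four`), then ALL ROWS OF ALL MATRICES OF `X` LIE IN ONE PLANE
`L = L_p` (`finrank L ≤ 2`): `X ⊆ Sym² L`, a binary net.  Proof by the slice argument of ✓ `finrank_prolong_le_four` read at
equality: at a letter `p` with `L_p ≠ 0`, `dim L_p = 1` would give `dim X⁽¹⁾ ≤ 3`; so `dim L_p ≥ 2`, `dim K_p ≤ 1`,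
`dim K_p⁽¹⁾ ≤ 1`, hence the slice map `X⁽¹⁾ → X`, `G ↦ G_p` has rank `≥ 3 = dim X` — it is ONTO `X` — and `K_p ≠ 0` gives
`dim L_p ≤ 2`; finally every `x ∈ X` is a slice `G_p`, so its `q`-th row `x_q = G(p,q,·) = G(q,p,·)` is the `p`-th row of the slice
`G_q ∈ X`, i.e. lies in `L_p`.

* ★ `exists_rows_le_two_of_finrank_prolong` — the theorem.

Honest framing.  A structure lemma; nothing about `(2,2,2)♭`, `CaptureIneqSym`, K1, `LaplaceOptimalFive` (OPEN · CONTESTED 72/120)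
or `VP ≠ VNP` is proved here.  No definitions, no `sorry`.
-/

set_option linter.dupNamespace false
set_option autoImplicit false

namespace Summit.ValiantsHypothesis.ValiantsHypothesis.Theorems.RigidityForcesSymmetryRankRigidMinimalRepr

namespace LaplaceFiveSeparatedCapture

open Finset

/-- ★ **BINARY NET.**  `X` symmetric, `finrank X ≤ 3`, `4 ≤ finrank (prolong X)` ⇒ there is a letter `p` with `finrank L_p ≤ 2`
such that every row of every matrix of `X` lies in `L_p = rowIm X p`. [folklore] -/
theorem exists_rows_le_two_of_finrank_prolong (X : Submodule ℂ (Fin 5 → Fin 5 → ℂ))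
    (hXs : ∀ x ∈ X, ∀ q r : Fin 5, x q r = x r q) (hX : Module.finrank ℂ X ≤ 3)
    (h4 : 4 ≤ Module.finrank ℂ (prolong X)) :
    ∃ p : Fin 5, Module.finrank ℂ (rowIm X p) ≤ 2 ∧ ∀ x ∈ X, ∀ q : Fin 5, x q ∈ rowIm X p := by
  classical
  have h0 : X ≠ ⊥ := by
    intro h
    subst h
    rw [prolong_bot, finrank_bot] at h4
    omega
  obtain ⟨p, hp⟩ := exists_finrank_rowIm_pos X h0
  have hrn := finrank_rowKer_add_finrank_rowIm X p
  have hstep := finrank_prolong_le_step X p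
  have hKs : ∀ x ∈ rowKer X p, ∀ q r : Fin 5, x q r = x r q := fun x hx => hXs x (rowKer_le X p hx)
  have hRX : Module.finrank ℂ (LinearMap.range ((sliceMap p).domRestrict (prolong X))) ≤ Module.finrank ℂ X :=
    Submodule.finrank_mono (range_slice_le X p)
  -- `dim L_p = 1` is impossible
  have h2 : 2 ≤ Module.finrank ℂ (rowIm X p) := by
    by_contra h1
    have hR := finrank_range_slice_le_one X hXs p (by omega)
    have hK := finrank_prolong_le_two (rowKer X p) hKs (by omega)
    omega
  -- so `dim K_p ≤ 1`, `dim K_p⁽¹⁾ ≤ 1`, the slice map is onto `X`, and `K_p ≠ 0`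
  have hK1 := finrank_prolong_le_one (rowKer X p) hKs (by omega)
  have hKne : 1 ≤ Module.finrank ℂ (rowKer X p) := by
    by_contra h
    have hb : rowKer X p = ⊥ := Submodule.finrank_eq_zero.mp (by omega)
    rw [hb, prolong_bot, finrank_bot] at hstep
    omega
  have hrange : LinearMap.range ((sliceMap p).domRestrict (prolong X)) = X :=
    Submodule.eq_of_le_of_finrank_le (range_slice_le X p) (by omega)
  refine ⟨p, by omega, fun x hx q => ?_⟩
  have hx' : x ∈ LinearMap.range ((sliceMap p).domRestrict (prolong X)) := by rw [hrange]; exact hx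
  obtain ⟨G, hG⟩ := LinearMap.mem_range.mp hx'
  rw [LinearMap.domRestrict_apply] at hG
  have hGp : (G : Fin 5 → Fin 5 → Fin 5 → ℂ) p = x := hG
  obtain ⟨hG12, -, hGs⟩ := (mem_prolong_iff X G).mp G.2
  have hxq : x q = (G : Fin 5 → Fin 5 → Fin 5 → ℂ) q p := by
    funext r
    rw [← hGp]
    exact hG12 p q r
  rw [hxq]
  exact Submodule.mem_map_of_mem (hGs q)

end LaplaceFiveSeparatedCapture

end Summit.ValiantsHypothesis.ValiantsHypothesis.Theorems.RigidityForcesSymmetryRankRigidMinimalRepr
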